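import Summits.QuantumFields.BalabanUV.Beta.D1BFx.HodgeIdentityForms
import Summits.QuantumFields.BalabanUV.Beta.D1BFx.GluonLeg

/-!
# `BalabanUV.Beta.D1BFx.StencilDictionaryTorus` — road «BF-x» for binder row D1, slot (K), X₁ brick Q2 «LOCAL STENCIL DICTIONARY an5 ↔ an2», FILE 2 (an5 side):
# an5's TORUS OPERATORS (`GradOp`, `GradOpᴴ = ∂*`, `Lap = Σ_ν ∇_νᴴ∇_ν`, `Q_k = QvOp`, `Q_kᴴ`, `Q*_kQ_k`, the local part of `Δ_a`) READ ON PERIODIC LIFTS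
# ALONG `castT` ARE an2's `ℤ^d` STENCILS (`dz`, `codiff₁`, `codiff₁∘dz` componentwise, `contourSum n`, `contourSumAdj n`)

WHY (`HOME/b2b-balaban-beta-d1-p2/X1-SPEC.md` v1 §1 brick Q2; owner `b2b-balaban-beta-d1-p2`).  The one analytic upstream (X₁a) of slot (K)'s kernel dictionary
is assembled (brick Q4) from an5's torus identity `DeltaA_t · calG_t = 1` (`B5DeltaA169.DeltaA_mul_calG`) on the even cubic volumes and the entrywise limit
`n²·Re calG_t → Kinf` (`VectorPropagatorLimit.calG_re_tendsto_Kinf`).  That needs an5's position-space operator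
`DeltaA = Lap − GradOp·PcT·GradOpᴴ + a•QvAdj·QvOp` (B5 (1.69)∕(1.73), CONTEXT ONLY) written in the currency of the road's (X₁a) operator
`½·curvAdj∘curv + dz∘Rf∘codiff₁ + (a∕n⁸)·𝒬ᵀ𝒬` (an2's `Beta/AffineAveraging` ∕ `AffineReproduction` stencils on `ℤ⁴`).  THIS FILE is the LOCAL half of that
dictionary, in the form that needs NO image sums and holds on EVERY torus `Tor N = Π_μ ℤ∕N_μ` (not only cubic ones): for a torus field `g`, let
`g♯ := liftT1 N g` (`g♯ κ x = g (castT N x, κ)`, an5's reduction `VectorTails.castT`); then, pointwise at every `x ∈ ℤ^d`,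
  `GradOp ↔ c·dz`, `GradOpᴴ = divS ↔ c̄·codiff₁`, `LapV c ↔ c̄c·(codiff₁∘dz)` on EACH component (so `Lap n M ↔ n²·codiff₁∘dz` = by FILE 1
  `HodgeIdentityForms` `n²·(½·curvAdj∘curv + dz∘codiff₁)`), `QvOp ↔ n^{−(d+1)}·contourSum n`, `QvOpᴴ ↔ n^{−(d+1)}·contourSumAdj n` (an2's floor form,
  via `B5Adjoint176.QvOp_adjoint_mulVec` + `blockOf (castT x) = castT (blk n x)`), `QvAdj·QvOp ↔ n^d·n^{−2(d+1)}·𝒬ᵀ𝒬 = n^{−(d+2)}·𝒬ᵀ𝒬` (X1-SPEC §0's `a∕n⁸` at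
  `d = 4` after the overall `n²`),
and `DeltaA` itself with the two local terms transcribed and the gauge sandwich `GradOp·PcT·GradOpᴴ` left in an5's torus form (brick Q3c identifies it with the
periodised `dz∘Pf∘codiff₁`).  The `periodise₂` ENTRY form of X1-SPEC §1 (cubic tori, an4's `EntrywiseVolumeLimit`) is the content of FILE 3; the operator-on-lift form
here is what «unfold the periodisation and regroup» consumes directly: a torus row sum `Σ_z T(x̄, z)·g z` of a local `T` IS the `ℤ^d` stencil applied to `g♯` at `x`.

WHAT THIS FILE PROVES (all [folklore]; two [our object] data definitions `liftT0`, `liftT1` asserting nothing):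
* §1 lifts and step bookkeeping: `liftT0`∕`liftT1` (+ `_apply`), `castT_add_unitVec`, `castT_sub_unitVec`, `tstep_eq_castT`.
* §2 `sdiff_mulVec_castT`, **`GradOp_mulVec_castT`** `(GradOp N c *ᵥ f) (castT N x, ν) = c * dz (liftT0 N f) ν x`, `divS_castT`,
  **`GradOp_conjTranspose_mulVec_castT`** `((GradOp N c)ᴴ *ᵥ g) (castT N x) = conj c * codiff₁ (liftT1 N g) x`.
* §3 `shiftM_conjTranspose_mulVec`, `fdiff_conjTranspose_mulVec_apply`, **`LapV_mulVec_apply`** (pointwise action of `Σ_ν ∇_νᴴ∇_ν` — the scalar `LapS` of B5 (1.21) on each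
  component; `B5Action121` had only the quadratic-form version `form_LapV`), `LapS_mulVec_castT`, **`LapV_mulVec_castT`**, **`Lap_mulVec_castT`**
  `(Lap n M *ᵥ g) (castT (fine n M) x, κ) = (n:ℂ)^2 * codiff₁ (dz (liftT1 (fine n M) g κ)) x`.
* §4 `up_castT`, `iota_eq_castT`, **`bpt_castT`** (`bpt (castT M y) j = castT (fine n M) (n • y + toSite j)`), `box_eq_image`, `finVec_val_injective`, **`blockOf_castT`**
  (`blockOf n M (castT (fine n M) x) = castT M (blk n x)`), **`QvOp_mulVec_castT`** `(QvOp n M *ᵥ g) (castT M y, μ) = 1∕n^{d+1} * contourSum n g♯ μ y`,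
  **`QvOp_adjoint_mulVec_castT`** (floor form `1∕n^{d+1} * Σ_{s<n} B (castT M (blk n (x − s•e_κ)), κ)`) + `_real` (= `1∕n^{d+1}·contourSumAdj n B♯` for real `B`),
  `QvOpH_QvOp_mulVec_castT` + `_real` (= `n^{−2(d+1)}·contourSumAdj n (contourSum n g♯)`), **`QvAdj_QvOp_mulVec_castT`**, `weight_QQ` (`n^d·(n^{−(d+1)})² = n^{−(d+2)}`).
* §5 **`DeltaA_mulVec_castT`** and **`DeltaA_mulVec_castT_hodge`**: `(Δ_a g)(x̄, κ) = n²·codiff₁ (dz (g♯ κ)) x − n·dz [PcT (∂ᴴg)]♯_κ(x) + a·n^d·n^{−2(d+1)}·Σ_{s<n} (contourSum n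
  g♯)_κ(blk n (x − s•e_κ))`, resp. with `n²·((2:ℂ)⁻¹·curvAdj (curv g♯) κ x + dz (codiff₁ g♯) κ x)` as the first term (FILE 1).

HONEST FRAMING (cell contract, verbatim): «discharging `BetaPertH` makes Bałaban's UV stability UNCONDITIONAL — a real constructive-QFT result; it is NOT the continuum
limit and NOT the Clay problem.»  HONEST DEPENDENCY (verbatim): «continuum YM on T⁴ ⇐ BetaPertH ∧ nine spine estimates (0/9 proved); BetaPertH ⇐ (D1) ∧ (D4) ∧ CAP+tail;
G-an2-4 gates asym, D1 and NE2/3/4.»  [folklore] index bookkeeping between two typists' carriers of the cell's OWN objects; B5's equation numbers are CONTEXT LOCATORS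
carried by the imported an5 modules, nothing printed is asserted here; no `Prop` is minted, nothing is cited, no wall binder is instantiated; (X₁a) is NOT touched (Q4
assembles; the gauge term is Q3's); 0 sorry.  NOT summit progress, NOT D1, NOT BetaPertH.
ABSOLUTE RULE (cell, verbatim): «No internally-minted statement may enter as a cited fact. Every hypothesis is either kernel-proved in this package or a verbatim quotation
of a PUBLISHED theorem with page reference. The manuscript(s) under audit are NOT citable for their own disputed steps — they are the thing under adjudication;
programme-internal (2001/route/tribunal) claims are never citable.»
Provenance: G-an2-4 swarm leaf seat `b2b-balaban-gan24-formalise-leaf-06` gen 28 (prover-b2b-balaban-gan24-formalise-leaf-06-g28-0; cross-lane idle-seat duty G-an2-4 → D1,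
road «BF-x», CLAIM «X1-Q2» journal l.19491; FILE 1 = `D1BFx/HodgeIdentityForms` p232119), 2026-08-20.
-/

namespace Summit.QuantumFields.BalabanUV.Beta.D1BFx.StencilDictionaryTorus

open Literature.MathematicalPhysics.QuantumFieldTheory.Balaban1983to89
open Literature.MathematicalPhysics.QuantumFieldTheory.Balaban1983to89.Beta
open B5Prop11Plancherel (Tor fine shiftM fdiff)
open B5Prop11Lower (Lap)
open B5Action121 (shiftS sdiff GradOp divS LapS LapV sdiff_mulVec divS_apply GradOp_mulVec GradOp_conjTranspose_mulVec
  shiftS_mulVec LapS_mulVec Lap_eq_LapV)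
open B5Block118 (QvOp QvOp_mulVec lineSum bpt tstep up iota upHom_intCast)
open B5Blocks16 (blockOf blockOf_bpt)
open B5Adjoint176 (QvOp_adjoint_mulVec)
open B5DeltaA169 (QvAdj DeltaA QvAdj_mulVec DeltaA_mulVec)
open B5Value126 (PcT)
open VectorTails (castT castT_add castT_neg castT_single)
open AffineAveraging (Site Form0 Form1 unitVec dz curv curvAdj codiff₁ box toSite blockSum contourSum)
open AffineReproduction (contourSumAdj)
open AveragingContours (blk off blk_add_off off_mem_box blk_block)
open scoped Matrix ComplexConjugate

noncomputable section

/-! ## §1 Lifts along the reduction `castT N : ℤ^d → Tor N` -/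

section Lift

variable {d : ℕ} (N : Fin d → ℕ)

/-- [our object] The periodic LIFT of a scalar torus field to `ℤ^d` along an5's reduction `castT N`: `(liftT0 N f) x = f (castT N x)`. -/
def liftT0 {R : Type*} (f : Tor N → R) : Form0 d R := fun x => f (castT N x)

/-- [our object] The periodic LIFT of a torus vector field (a function on bonds `(x̄, κ)`) to an an2 1-form on `ℤ^d`:
`(liftT1 N g) κ x = g (castT N x, κ)`. -/
def liftT1 {R : Type*} (g : Tor N × Fin d → R) : Form1 d R := fun κ x => g (castT N x, κ)

/-- [folklore] Entries of `liftT0`. -/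
@[simp] theorem liftT0_apply {R : Type*} (f : Tor N → R) (x : Site d) : liftT0 N f x = f (castT N x) := rfl

/-- [folklore] Entries of `liftT1`. -/
@[simp] theorem liftT1_apply {R : Type*} (g : Tor N × Fin d → R) (κ : Fin d) (x : Site d) :
    liftT1 N g κ x = g (castT N x, κ) := rfl

/-- [folklore] The reduction takes an2's unit step to an5's: `castT N (x + e_κ) = castT N x + e_κ`. -/
theorem castT_add_unitVec (x : Site d) (κ : Fin d) :
    castT N (x + unitVec κ) = castT N x + B5Prop11Plancherel.unitVec N κ := by
  rw [castT_add, AffineAveraging.unitVec, castT_single]; rfl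

/-- [folklore] `castT N (x − e_κ) = castT N x − e_κ`. -/
theorem castT_sub_unitVec (x : Site d) (κ : Fin d) :
    castT N (x - unitVec κ) = castT N x - B5Prop11Plancherel.unitVec N κ := by
  rw [sub_eq_add_neg, castT_add, castT_neg, AffineAveraging.unitVec, castT_single, ← sub_eq_add_neg]; rfl

/-- [folklore] an5's `t` fine steps in direction `μ` is the reduction of `t • e_μ`. -/
theorem tstep_eq_castT (μ : Fin d) (t : ℕ) : tstep N μ t = castT N ((t : ℤ) • unitVec μ) := by
  funext ν
  simp only [tstep, castT, Pi.smul_apply, AffineAveraging.unitVec_apply, smul_eq_mul]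
  split_ifs with h
  · simp
  · simp

end Lift

/-! ## §2 Differences: `GradOp ↔ dz`, `GradOpᴴ = divS ↔ codiff₁` -/

section Differences

variable {d : ℕ} (N : Fin d → ℕ) [hN : ∀ μ, NeZero (N μ)]

/-- [folklore] an5's forward difference read on the lift: `(∂_ν f)(x̄) = c·(dz f♯)_ν(x)`. -/
theorem sdiff_mulVec_castT (c : ℂ) (ν : Fin d) (f : Tor N → ℂ) (x : Site d) :
    (sdiff N c ν *ᵥ f) (castT N x) = c * dz (liftT0 N f) ν x := by
  rw [sdiff_mulVec, dz, liftT0_apply, liftT0_apply, castT_add_unitVec]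

/-- [folklore] **`GradOp ↔ dz`**: `(∂f)(x̄, ν) = c·(dz f♯)_ν(x)` — an5's gradient of a torus scalar IS an2's `dz` of its lift. -/
theorem GradOp_mulVec_castT (c : ℂ) (f : Tor N → ℂ) (x : Site d) (ν : Fin d) :
    (GradOp N c *ᵥ f) (castT N x, ν) = c * dz (liftT0 N f) ν x := by
  rw [GradOp_mulVec, sdiff_mulVec_castT]

/-- [folklore] **`divS ↔ codiff₁`**: `(∂*g)(x̄) = c̄·(codiff₁ g♯)(x)` — an5's divergence IS an2's codifferential of the lift. -/
theorem divS_castT (c : ℂ) (g : Tor N × Fin d → ℂ) (x : Site d) :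
    divS N c g (castT N x) = conj c * codiff₁ (liftT1 N g) x := by
  rw [divS_apply, codiff₁, Finset.mul_sum]
  refine Finset.sum_congr rfl fun μ _ => ?_
  rw [liftT1_apply, liftT1_apply, castT_sub_unitVec]

/-- [folklore] **`GradOpᴴ ↔ codiff₁`**: `((∂)ᴴ g)(x̄) = c̄·(codiff₁ g♯)(x)`. -/
theorem GradOp_conjTranspose_mulVec_castT (c : ℂ) (g : Tor N × Fin d → ℂ) (x : Site d) :
    ((GradOp N c)ᴴ *ᵥ g) (castT N x) = conj c * codiff₁ (liftT1 N g) x := by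
  rw [GradOp_conjTranspose_mulVec, divS_castT]

end Differences

/-! ## §3 The vector Laplacian: `Lap ↔ codiff₁ ∘ dz` componentwise -/

section Laplacian

variable {d : ℕ} (N : Fin d → ℕ) [hN : ∀ μ, NeZero (N μ)]

/-- [folklore] `((S_ν)ᴴ A)_κ(x) = A_κ(x − e_ν)` for an5's vector-index translation. -/
theorem shiftM_conjTranspose_mulVec (ν : Fin d) (A : Tor N × Fin d → ℂ) (x : Tor N) (κ : Fin d) :
    ((shiftM N ν)ᴴ *ᵥ A) (x, κ) = A (x - B5Prop11Plancherel.unitVec N ν, κ) := by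
  simp only [Matrix.mulVec, dotProduct, Matrix.conjTranspose_apply, shiftM]
  rw [Finset.sum_eq_single (x - B5Prop11Plancherel.unitVec N ν, κ)]
  · simp
  · intro j _ hj
    rw [if_neg, star_zero, zero_mul]
    intro h
    apply hj
    rw [Prod.ext_iff] at h ⊢
    obtain ⟨h1, h2⟩ := h
    simp only at h1 h2 ⊢
    exact ⟨by rw [h1, add_sub_cancel_right], h2.symm⟩
  · intro h; exact absurd (Finset.mem_univ _) h

/-- [folklore] `((∇_ν)ᴴ A)_κ(x) = c̄·(A_κ(x − e_ν) − A_κ(x))`. -/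
theorem fdiff_conjTranspose_mulVec_apply (c : ℂ) (ν : Fin d) (A : Tor N × Fin d → ℂ) (x : Tor N) (κ : Fin d) :
    ((fdiff N c ν)ᴴ *ᵥ A) (x, κ) = conj c * (A (x - B5Prop11Plancherel.unitVec N ν, κ) - A (x, κ)) := by
  simp only [fdiff, Matrix.conjTranspose_smul, Matrix.conjTranspose_sub, Matrix.conjTranspose_one, Matrix.smul_mulVec,
    Matrix.sub_mulVec, Matrix.one_mulVec, Pi.smul_apply, Pi.sub_apply, shiftM_conjTranspose_mulVec, smul_eq_mul,
    Complex.star_def]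

/-- [folklore] **POINTWISE ACTION OF an5's VECTOR LAPLACIAN**: `(Σ_ν ∇_νᴴ∇_ν A)_κ(x) = Σ_ν c̄c·(2A_κ(x) − A_κ(x + e_ν) − A_κ(x − e_ν))`
— the scalar `LapS` of (1.21) on the component `κ` (`B5Action121.form_LapV` is the quadratic-form version). -/
theorem LapV_mulVec_apply (c : ℂ) (A : Tor N × Fin d → ℂ) (x : Tor N) (κ : Fin d) :
    (LapV N c *ᵥ A) (x, κ)
      = ∑ ν, conj c * c * (2 * A (x, κ) - A (x + B5Prop11Plancherel.unitVec N ν, κ)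
          - A (x - B5Prop11Plancherel.unitVec N ν, κ)) := by
  simp only [LapV, Matrix.sum_mulVec, Finset.sum_apply, ← Matrix.mulVec_mulVec, fdiff_conjTranspose_mulVec_apply,
    B5Action121.fdiff_mulVec_apply, sdiff_mulVec, B5Action121.comp, sub_add_cancel]
  refine Finset.sum_congr rfl fun ν _ => ?_
  ring

/-- [folklore] an5's scalar Laplacian read on the lift: `(Δf)(x̄) = c̄c·codiff₁ (dz f♯)(x)` (the positive Laplacian `−Δ` in an2's
currency, `codiff₁ ∘ dz`). -/
theorem LapS_mulVec_castT (c : ℂ) (f : Tor N → ℂ) (x : Site d) :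
    (LapS N c *ᵥ f) (castT N x) = conj c * c * codiff₁ (dz (liftT0 N f)) x := by
  rw [LapS_mulVec, codiff₁, Finset.mul_sum]
  refine Finset.sum_congr rfl fun ν _ => ?_
  simp only [dz, liftT0_apply, castT_add_unitVec, castT_sub_unitVec, sub_add_cancel]
  ring

/-- [folklore] **`Lap ↔ codiff₁∘dz` COMPONENTWISE**: `(Σ_ν ∇_νᴴ∇_ν g)(x̄, κ) = c̄c · codiff₁ (dz (g♯ κ)) x` — an5's vector Laplacian IS
an2's positive scalar Laplacian on each component of the lift (by FILE 1 `HodgeIdentityForms` this is `½·curvAdj∘curv + dz∘codiff₁`). -/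
theorem LapV_mulVec_castT (c : ℂ) (g : Tor N × Fin d → ℂ) (x : Site d) (κ : Fin d) :
    (LapV N c *ᵥ g) (castT N x, κ) = conj c * c * codiff₁ (dz (liftT1 N g κ)) x := by
  rw [LapV_mulVec_apply, codiff₁, Finset.mul_sum]
  refine Finset.sum_congr rfl fun ν _ => ?_
  simp only [dz, liftT1_apply, castT_add_unitVec, castT_sub_unitVec, sub_add_cancel]
  ring

variable (n : ℕ) [NeZero n] (M : Fin d → ℕ) [hM : ∀ μ, NeZero (M μ)]

/-- [folklore] **an5's `Lap n M` (fine torus `T_η`, `η = 1∕n`) on the lift: `(Lap g)(x̄, κ) = n² · codiff₁ (dz (g♯ κ)) x`.** -/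
theorem Lap_mulVec_castT (g : Tor (fine n M) × Fin d → ℂ) (x : Site d) (κ : Fin d) :
    (Lap n M *ᵥ g) (castT (fine n M) x, κ) = ((n : ℂ) ^ 2) * codiff₁ (dz (liftT1 (fine n M) g κ)) x := by
  rw [Lap_eq_LapV, LapV_mulVec_castT, Complex.conj_natCast, sq]

end Laplacian

/-! ## §4 Block averaging: `QvOp ↔ contourSum`, `QvOpᴴ ↔ contourSumAdj` (floor form), `Q*Q` -/

section Averaging

variable {d : ℕ} (n : ℕ) [NeZero n] (M : Fin d → ℕ) [hM : ∀ μ, NeZero (M μ)]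

omit [NeZero n] hM in
/-- [folklore] an5's coarse-to-fine embedding on reductions: `up (castT M y) = castT (fine n M) (n • y)`. -/
theorem up_castT (y : Site d) : up n M (castT M y) = castT (fine n M) ((n : ℤ) • y) := by
  funext ν
  simp only [up, castT, Pi.smul_apply, smul_eq_mul, Int.cast_mul, Int.cast_natCast]
  exact upHom_intCast n M ν (y ν)

omit [NeZero n] hM in
/-- [folklore] an5's in-block offset is the reduction of an2's `toSite`: `iota j = castT (fine n M) (toSite j)`. -/
theorem iota_eq_castT (j : Fin d → Fin n) : iota n M j = castT (fine n M) (toSite fun i => (j i : ℕ)) := by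
  funext ν
  simp [iota, castT, toSite]

omit [NeZero n] hM in
/-- [folklore] **BLOCK POINTS**: `bpt (castT M y) j = castT (fine n M) (n • y + toSite j)` — an5's `n·y + j` IS the reduction of an2's block
point. -/
theorem bpt_castT (y : Site d) (j : Fin d → Fin n) :
    bpt n M (castT M y) j = castT (fine n M) ((n : ℤ) • y + toSite fun i => (j i : ℕ)) := by
  rw [bpt, up_castT, iota_eq_castT, castT_add]

omit [NeZero n] in
/-- [folklore] an2's box `{0,…,n−1}^d ⊂ ℕ^d` is the image of `Fin d → Fin n`. -/
theorem box_eq_image : box d n = Finset.univ.image (fun j : Fin d → Fin n => fun i => (j i : ℕ)) := by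
  ext b
  simp only [box, Fintype.mem_piFinset, Finset.mem_range, Finset.mem_image, Finset.mem_univ, true_and]
  constructor
  · intro hb
    exact ⟨fun i => ⟨b i, hb i⟩, rfl⟩
  · rintro ⟨j, rfl⟩ i
    exact (j i).isLt

omit [NeZero n] in
/-- [folklore] The coercion `(Fin d → Fin n) → (Fin d → ℕ)` is injective. -/
theorem finVec_val_injective : Function.Injective (fun j : Fin d → Fin n => fun i => (j i : ℕ)) := by
  intro j j' h
  funext i
  exact Fin.ext (congrFun h i)

/-- [folklore] **THE BLOCK OF A REDUCED POINT**: `blockOf (castT (fine n M) x) = castT M (blk n x)` — an5's block label IS the reduction of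
an2's floor quotient `blk n x = (⌊x_i ∕ n⌋)_i` (`AveragingContours.blk_add_off`, `B5Blocks16.blockOf_bpt`). -/
theorem blockOf_castT (x : Site d) : blockOf n M (castT (fine n M) x) = castT M (blk n x) := by
  have hn : 1 ≤ n := NeZero.one_le
  have hoff : ∀ i, off n x i < n := by
    have h := off_mem_box hn x
    simpa [box, Fintype.mem_piFinset, Finset.mem_range] using h
  have hx : castT (fine n M) x = bpt n M (castT M (blk n x)) (fun i => ⟨off n x i, hoff i⟩) := by
    rw [bpt_castT]
    congr 1
    exact (blk_add_off hn x).symm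
  rw [hx, blockOf_bpt]

/-- [folklore] **`QvOp ↔ contourSum`**: `(Q_k g)(ȳ, μ) = n^{−(d+1)} · (contourSum n g♯)_μ(y)` — an5's (1.18) averaging of a torus vector field,
read at a reduced coarse point, IS an2's un-normalised straight-contour block sum of the lift (weight `η^{d+1} = n^{−(d+1)}`). -/
theorem QvOp_mulVec_castT (g : Tor (fine n M) × Fin d → ℂ) (y : Site d) (μ : Fin d) :
    (QvOp n M *ᵥ g) (castT M y, μ) = 1 / (n : ℂ) ^ (d + 1) * contourSum n (liftT1 (fine n M) g) μ y := by
  rw [QvOp_mulVec, contourSum, box_eq_image n, Finset.sum_image fun j _ j' _ h => finVec_val_injective n h]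
  congr 1
  refine Finset.sum_congr rfl fun j _ => ?_
  rw [lineSum, Finset.sum_range (f := fun s =>
    liftT1 (fine n M) g μ ((n : ℤ) • y + toSite (fun i => (j i : ℕ)) + (s : ℤ) • unitVec μ))]
  refine Finset.sum_congr rfl fun t _ => ?_
  rw [liftT1_apply, castT_add, bpt_castT, tstep_eq_castT]

/-- [folklore] **`QvOpᴴ ↔ contourSumAdj` (floor form)**: `((Q_k)ᴴ B)(x̄, κ) = n^{−(d+1)} · Σ_{s<n} B(blk n (x − s e_κ)‾, κ)` — an5's
`B5Adjoint176.QvOp_adjoint_mulVec` at a reduced point is an2's `contourSumAdj` formula on the lift (complex scalars; the `ℝ` packaging in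
`AffineReproduction.contourSumAdj`'s own name is `QvOp_adjoint_mulVec_castT_real`). -/
theorem QvOp_adjoint_mulVec_castT (B : Tor M × Fin d → ℂ) (x : Site d) (κ : Fin d) :
    ((QvOp n M)ᴴ *ᵥ B) (castT (fine n M) x, κ)
      = 1 / (n : ℂ) ^ (d + 1) * ∑ s ∈ Finset.range n, B (castT M (blk n (x - (s : ℤ) • unitVec κ)), κ) := by
  rw [QvOp_adjoint_mulVec, Finset.sum_range (f := fun s => B (castT M (blk n (x - (s : ℤ) • unitVec κ)), κ))]
  congr 1
  refine Finset.sum_congr rfl fun t _ => ?_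
  rw [tstep_eq_castT, ← VectorPropagatorLimit.castT_sub, blockOf_castT]

/-- [folklore] The same for a REAL coarse field, in an2's vocabulary: `((Q_k)ᴴ B)(x̄, κ) = n^{−(d+1)} · (contourSumAdj n B♯)_κ(x)`. -/
theorem QvOp_adjoint_mulVec_castT_real (B : Tor M × Fin d → ℝ) (x : Site d) (κ : Fin d) :
    ((QvOp n M)ᴴ *ᵥ fun b => (B b : ℂ)) (castT (fine n M) x, κ)
      = ((1 / (n : ℝ) ^ (d + 1) * contourSumAdj n (liftT1 M B) κ x : ℝ) : ℂ) := by
  rw [QvOp_adjoint_mulVec_castT, contourSumAdj]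
  push_cast
  rfl

/-- [folklore] **`QᴴQ` ON THE LIFT**: `((Q_k)ᴴ Q_k g)(x̄, κ) = n^{−2(d+1)} · Σ_{s<n} (contourSum n g♯)_κ(blk n (x − s e_κ))` (= an2's
`contourSumAdj n (contourSum n g♯)` in floor form). -/
theorem QvOpH_QvOp_mulVec_castT (g : Tor (fine n M) × Fin d → ℂ) (x : Site d) (κ : Fin d) :
    ((QvOp n M)ᴴ *ᵥ (QvOp n M *ᵥ g)) (castT (fine n M) x, κ)
      = (1 / (n : ℂ) ^ (d + 1)) ^ 2 *
          ∑ s ∈ Finset.range n, contourSum n (liftT1 (fine n M) g) κ (blk n (x - (s : ℤ) • unitVec κ)) := by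
  rw [QvOp_adjoint_mulVec_castT]
  simp_rw [QvOp_mulVec_castT]
  rw [← Finset.mul_sum, sq, mul_assoc]

/-- [folklore] The same for a REAL fine field in an2's vocabulary: `((Q_k)ᴴ Q_k g)(x̄, κ) = n^{−2(d+1)} · (contourSumAdj n (contourSum n g♯))_κ(x)`. -/
theorem QvOpH_QvOp_mulVec_castT_real (g : Tor (fine n M) × Fin d → ℝ) (x : Site d) (κ : Fin d) :
    ((QvOp n M)ᴴ *ᵥ (QvOp n M *ᵥ fun i => (g i : ℂ))) (castT (fine n M) x, κ)
      = (((1 / (n : ℝ) ^ (d + 1)) ^ 2 * contourSumAdj n (contourSum n (liftT1 (fine n M) g)) κ x : ℝ) : ℂ) := by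
  rw [QvOpH_QvOp_mulVec_castT, contourSumAdj]
  push_cast
  simp only [contourSum, liftT1_apply, Complex.ofReal_sum]
  rfl

/-- [folklore] **`Q*Q = a•QvAdj·QvOp`'s core on the lift**: `((Q*_k Q_k) g)(x̄, κ) = n^d · n^{−2(d+1)} · Σ_{s<n} (contourSum n g♯)_κ(blk n (x − s e_κ))`
(`QvAdj = n^d • QvOpᴴ`), i.e. the weight `n^{−(d+2)}` of X1-SPEC §0 (`a∕n⁸` at `d = 4` after the overall `n²`). -/
theorem QvAdj_QvOp_mulVec_castT (g : Tor (fine n M) × Fin d → ℂ) (x : Site d) (κ : Fin d) :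
    ((QvAdj n M * QvOp n M) *ᵥ g) (castT (fine n M) x, κ)
      = (n : ℂ) ^ d * (1 / (n : ℂ) ^ (d + 1)) ^ 2 *
          ∑ s ∈ Finset.range n, contourSum n (liftT1 (fine n M) g) κ (blk n (x - (s : ℤ) • unitVec κ)) := by
  rw [← Matrix.mulVec_mulVec, QvAdj_mulVec, Pi.smul_apply, smul_eq_mul, QvOpH_QvOp_mulVec_castT, mul_assoc]

/-- [folklore] The weight arithmetic: `n^d · (n^{−(d+1)})² = n^{−(d+2)}`. -/
theorem weight_QQ : (n : ℂ) ^ d * (1 / (n : ℂ) ^ (d + 1)) ^ 2 = 1 / (n : ℂ) ^ (d + 2) := by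
  have hn : (n : ℂ) ≠ 0 := by exact_mod_cast NeZero.ne n
  field_simp
  ring

end Averaging

/-! ## §5 an5's `Δ_a` read on the lift: the two LOCAL terms in an2's currency (the gauge sandwich left verbatim for brick Q3c) -/

section DeltaA

variable {d : ℕ} (n : ℕ) [NeZero n] (M : Fin d → ℕ) [hM : ∀ μ, NeZero (M μ)] (a : ℝ)

/-- [folklore] **`Δ_a` ON THE LIFT, LOCAL TERMS TRANSCRIBED**: for every complex torus vector field `g` on `T_η` and every `x ∈ ℤ^d`,
`(Δ_a g)(x̄, κ) = n²·codiff₁ (dz (g♯ κ)) x − n·dz [PcT (∂ᴴg)]♯_κ(x) + a·n^d·n^{−2(d+1)}·Σ_{s<n} (contourSum n g♯)_κ(blk n (x − s e_κ))` — the vector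
Laplacian and the averaging term in an2's currency (§3, §4), the gauge sandwich `∂·P·∂ᴴ` with an5's torus projector `PcT` read through
`GradOp_mulVec_castT` only (its identification with the periodised `Pker` word is brick Q3c). -/
theorem DeltaA_mulVec_castT (g : Tor (fine n M) × Fin d → ℂ) (x : Site d) (κ : Fin d) :
    (DeltaA n M a *ᵥ g) (castT (fine n M) x, κ)
      = (n : ℂ) ^ 2 * codiff₁ (dz (liftT1 (fine n M) g κ)) x
        - (n : ℂ) * dz (liftT0 (fine n M) (PcT n M (n : ℂ) *ᵥ ((GradOp (fine n M) (n : ℂ))ᴴ *ᵥ g))) κ x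
        + (a : ℂ) * (n : ℂ) ^ d * ((1 / (n : ℂ) ^ (d + 1)) ^ 2 *
            ∑ s ∈ Finset.range n, contourSum n (liftT1 (fine n M) g) κ (blk n (x - (s : ℤ) • unitVec κ))) := by
  rw [DeltaA_mulVec, Pi.add_apply, Pi.sub_apply, Pi.smul_apply, smul_eq_mul, Lap_mulVec_castT, GradOp_mulVec_castT,
    QvOpH_QvOp_mulVec_castT, mul_assoc]

/-- [folklore] **THE SAME WITH THE HODGE IDENTITY OF FILE 1** (`HodgeIdentityForms.half_curvAdj_curv_add_dz_codiff₁`): the `Lap` term is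
`n²·((2:ℂ)⁻¹·curvAdj (curv g♯) κ x + dz (codiff₁ g♯) κ x)` — X1-SPEC §0's `n²·[½S + dδ]` on the lift, with the gauge projector still in an5's
torus form and the averaging term in floor form. -/
theorem DeltaA_mulVec_castT_hodge (g : Tor (fine n M) × Fin d → ℂ) (x : Site d) (κ : Fin d) :
    (DeltaA n M a *ᵥ g) (castT (fine n M) x, κ)
      = (n : ℂ) ^ 2 * ((2 : ℂ)⁻¹ * curvAdj (curv (liftT1 (fine n M) g)) κ x + dz (codiff₁ (liftT1 (fine n M) g)) κ x)
        - (n : ℂ) * dz (liftT0 (fine n M) (PcT n M (n : ℂ) *ᵥ ((GradOp (fine n M) (n : ℂ))ᴴ *ᵥ g))) κ x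
        + (a : ℂ) * (n : ℂ) ^ d * ((1 / (n : ℂ) ^ (d + 1)) ^ 2 *
            ∑ s ∈ Finset.range n, contourSum n (liftT1 (fine n M) g) κ (blk n (x - (s : ℤ) • unitVec κ))) := by
  rw [DeltaA_mulVec_castT, HodgeIdentityForms.half_curvAdj_curv_add_dz_codiff₁ two_ne_zero]

end DeltaA

end

end Summit.QuantumFields.BalabanUV.Beta.D1BFx.StencilDictionaryTorus
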